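import Mathlib
import Summits.KontsevichZagierPeriods.Zeta5Search.Elimination.DictStarTransport
import Summits.KontsevichZagierPeriods.Zeta5Search.Elimination.PencilGauge
import Summits.KontsevichZagierPeriods.Zeta5Search.Elimination.PencilDescentSharp
import Summits.KontsevichZagierPeriods.Zeta5Search.Elimination.DictPencilAxis
import Summits.KontsevichZagierPeriods.Zeta5Search.Elimination.DictPencilLevelOne
import HarnessLib

/-!
# gen-1's dictionary STAR node `DictStar` holds (cell `pub-zeta5`, fam-elim E-L25d)

HONEST FRAMING: systematic search; no irrationality claim unless certified.  Identities among gen-1's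
rational dictionary data (coefficients `U, W, V`, the proved symmetric gauge `ρ`, the dictionary coordinates
`Q, P̂, P` on the region); no cellular integral is evaluated, no numerics, nothing moves a record.  The
descent corollaries at the end stay CONDITIONAL on the displayed cellular-side hypotheses.

OUR work (Summit side; fam-elim gen 25, 2026-08-21).
* `starPi_gauge` (`_one … _seven`): `P_s·edgeProd(P,s)·fanCoeff(P,s) = χ_s(P)·π_s(P)` (edge partners and
  non-edge partners of `s` together are all the other slots);
* `dictStar_top`: multiplying the gauge-free STAR `DictStarTransport.star_wedge` by `ρ(P)` and using the
  slot-step gauge law `PencilGauge.rhoB_lower` gives gen-1's `WedgeDictionaryThreeTerm.DictStar` POINTWISE at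
  every `(a; i, k)` with `b(a)₀ ≥ 2` — zero slots allowed;
* `dictStar_level_one`: at level `≤ 1` the region forces `P_i = P_k = 1` on a non-edge pair, so all three
  coefficients `starKappa`, `fanCoeff(P,k)`, `fanCoeff(P,i)` vanish and the instance is trivial;
* `dictStar_holds : DictStar` — gen-1's node, unconditionally;
* `explicitPQ_of_cells`: with E-L24 (`dictPencilAxis_holds`) and cert-1 g5's `dictPencilLevelOne_holds`, the
  sharp descent `PencilDescentSharp.explicitPQ_of_terminal_sharp` now needs only the CELLULAR-side families
  `CellStar`, `CellPencil` and the terminal values; `cellStar_of_explicitPQ'`: conversely `explicitPQ → CellStar`.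

References: [Zudilin2002c] W. Zudilin, arXiv:math/0206176 (2002), §8; [Brown2014] F. Brown, arXiv:1412.6508;
[BrownZudilin2022] F. Brown, W. Zudilin, arXiv:2210.03391.
-/

open Finset

namespace Summit.KontsevichZagierPeriods.Zeta5Search.Elimination

open Summit.KontsevichZagierPeriods.Zeta5Search.DualSeries (InBox)
open Summit.KontsevichZagierPeriods.Zeta5Search.WedgeDictionary
open Summit.KontsevichZagierPeriods.Zeta5Search.SymmetricGauge
open Literature.NumberTheory.Irrationality.BrownZudilin2022 (bOfA Converges QOf convergenceForms)

/-! ## 1. The gauge and gen-1's `DictStar` above level one -/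


/-- The gauge identity at slot 1 (one declaration per slot keeps each `ring` certificate small). -/
theorem starPi_gauge_one (P : ℕ → ℤ) :
    (P 1 : ℚ) * edgeProd P 1 * (fanCoeff P 1 : ℚ) = (chiOf P 1 : ℚ) * starPi P 1 := by
  simp (config := { decide := true }) only [fanCoeff, chiOf, nonEdgePartners, edgeProd, Epairs, starPi,
    List.map_cons, List.map_nil, List.prod_cons, List.prod_nil, prod_range_succ, prod_range_zero, ite_true,
    ite_false, Nat.reduceAdd, one_mul, mul_one, Int.cast_mul, Int.cast_sub, Int.cast_add, Int.cast_one]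
  all_goals ring

/-- The gauge identity at slot 2 (one declaration per slot keeps each `ring` certificate small). -/
theorem starPi_gauge_two (P : ℕ → ℤ) :
    (P 2 : ℚ) * edgeProd P 2 * (fanCoeff P 2 : ℚ) = (chiOf P 2 : ℚ) * starPi P 2 := by
  simp (config := { decide := true }) only [fanCoeff, chiOf, nonEdgePartners, edgeProd, Epairs, starPi,
    List.map_cons, List.map_nil, List.prod_cons, List.prod_nil, prod_range_succ, prod_range_zero, ite_true,
    ite_false, Nat.reduceAdd, one_mul, mul_one, Int.cast_mul, Int.cast_sub, Int.cast_add, Int.cast_one]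
  all_goals ring

/-- The gauge identity at slot 3 (one declaration per slot keeps each `ring` certificate small). -/
theorem starPi_gauge_three (P : ℕ → ℤ) :
    (P 3 : ℚ) * edgeProd P 3 * (fanCoeff P 3 : ℚ) = (chiOf P 3 : ℚ) * starPi P 3 := by
  simp (config := { decide := true }) only [fanCoeff, chiOf, nonEdgePartners, edgeProd, Epairs, starPi,
    List.map_cons, List.map_nil, List.prod_cons, List.prod_nil, prod_range_succ, prod_range_zero, ite_true,
    ite_false, Nat.reduceAdd, one_mul, mul_one, Int.cast_mul, Int.cast_sub, Int.cast_add, Int.cast_one]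
  all_goals ring

/-- The gauge identity at slot 4 (one declaration per slot keeps each `ring` certificate small). -/
theorem starPi_gauge_four (P : ℕ → ℤ) :
    (P 4 : ℚ) * edgeProd P 4 * (fanCoeff P 4 : ℚ) = (chiOf P 4 : ℚ) * starPi P 4 := by
  simp (config := { decide := true }) only [fanCoeff, chiOf, nonEdgePartners, edgeProd, Epairs, starPi,
    List.map_cons, List.map_nil, List.prod_cons, List.prod_nil, prod_range_succ, prod_range_zero, ite_true,
    ite_false, Nat.reduceAdd, one_mul, mul_one, Int.cast_mul, Int.cast_sub, Int.cast_add, Int.cast_one]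
  all_goals ring

/-- The gauge identity at slot 5 (one declaration per slot keeps each `ring` certificate small). -/
theorem starPi_gauge_five (P : ℕ → ℤ) :
    (P 5 : ℚ) * edgeProd P 5 * (fanCoeff P 5 : ℚ) = (chiOf P 5 : ℚ) * starPi P 5 := by
  simp (config := { decide := true }) only [fanCoeff, chiOf, nonEdgePartners, edgeProd, Epairs, starPi,
    List.map_cons, List.map_nil, List.prod_cons, List.prod_nil, prod_range_succ, prod_range_zero, ite_true,
    ite_false, Nat.reduceAdd, one_mul, mul_one, Int.cast_mul, Int.cast_sub, Int.cast_add, Int.cast_one]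
  all_goals ring

/-- The gauge identity at slot 6 (one declaration per slot keeps each `ring` certificate small). -/
theorem starPi_gauge_six (P : ℕ → ℤ) :
    (P 6 : ℚ) * edgeProd P 6 * (fanCoeff P 6 : ℚ) = (chiOf P 6 : ℚ) * starPi P 6 := by
  simp (config := { decide := true }) only [fanCoeff, chiOf, nonEdgePartners, edgeProd, Epairs, starPi,
    List.map_cons, List.map_nil, List.prod_cons, List.prod_nil, prod_range_succ, prod_range_zero, ite_true,
    ite_false, Nat.reduceAdd, one_mul, mul_one, Int.cast_mul, Int.cast_sub, Int.cast_add, Int.cast_one]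
  all_goals ring

/-- The gauge identity at slot 7 (one declaration per slot keeps each `ring` certificate small). -/
theorem starPi_gauge_seven (P : ℕ → ℤ) :
    (P 7 : ℚ) * edgeProd P 7 * (fanCoeff P 7 : ℚ) = (chiOf P 7 : ℚ) * starPi P 7 := by
  simp (config := { decide := true }) only [fanCoeff, chiOf, nonEdgePartners, edgeProd, Epairs, starPi,
    List.map_cons, List.map_nil, List.prod_cons, List.prod_nil, prod_range_succ, prod_range_zero, ite_true,
    ite_false, Nat.reduceAdd, one_mul, mul_one, Int.cast_mul, Int.cast_sub, Int.cast_add, Int.cast_one]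
  all_goals ring

/-- `P_s · edgeProd(P,s) · fanCoeff(P,s) = χ_s(P) · π_s(P)` for `s ∈ [1,7]`: the edge partners and the non-edge
partners of `s` together are exactly the other six slots. -/
theorem starPi_gauge (P : ℕ → ℤ) {s : ℕ} (hs : s ∈ Icc 1 7) :
    (P s : ℚ) * edgeProd P s * (fanCoeff P s : ℚ) = (chiOf P s : ℚ) * starPi P s := by
  obtain ⟨h1, h7⟩ := mem_Icc.1 hs
  interval_cases s
  exacts [starPi_gauge_one P, starPi_gauge_two P, starPi_gauge_three P, starPi_gauge_four P,
    starPi_gauge_five P, starPi_gauge_six P, starPi_gauge_seven P]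

/-- Scalar skeleton of the zero-slot STAR: the gauge-free relation `W`, the two slot-step gauges, the two
polynomial identities, `d + 1 ≠ 0` and `χ_k, χ_i ≠ 0`. -/
theorem starTop_assemble {dp1 κ X0 πk Xk πi Xi ρ ρk ρi χk χi Pk Pi Ek Ei fk fi : ℚ}
    (hW : dp1 * κ * X0 + πk * Xk - πi * Xi = 0) (hGk : ρk * dp1 * χk = -(Pk * Ek * ρ))
    (hGi : ρi * dp1 * χi = -(Pi * Ei * ρ)) (hSk : Pk * Ek * fk = χk * πk) (hSi : Pi * Ei * fi = χi * πi)
    (hd : dp1 ≠ 0) (hχk : χk ≠ 0) (hχi : χi ≠ 0) :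
    κ * (ρ * X0) + (-fk) * (ρk * Xk) + fi * (ρi * Xi) = 0 := by
  have key : (dp1 * χk * χi) * (κ * (ρ * X0) + (-fk) * (ρk * Xk) + fi * (ρi * Xi)) = 0 := by
    linear_combination (χk * χi * ρ) * hW + (-(χi * fk * Xk)) * hGk + (χk * fi * Xi) * hGi +
      (χi * ρ * Xk) * hSk + (-(χk * ρ * Xi)) * hSi
  rcases mul_eq_zero.1 key with h | h
  · exact absurd h (mul_ne_zero (mul_ne_zero hd hχk) hχi)
  · exact h

/-- **STAR — gen-1's `DictStar` pointwise above level one.**  For slots `i ≠ k` in `[1,7]`, `RegionHyp` at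
`a`, `a − s_k`, `a − s_i` and `b(a)₀ ≥ 2`:
`starKappa(P,i,k)·v(a) − fanCoeff(P,k)·v(a − s_k) + fanCoeff(P,i)·v(a − s_i) = 0` (`P = b(a)`) for the three
dictionary coordinates — the instance of `WedgeDictionaryThreeTerm.DictStar` at `(a, i, k)`, zero slots allowed.
(`RegionHyp` at `a − s_k`, `a − s_i` forces `P_i, P_k ≥ 1`; the region gives `d(P) ≥ 0`, slots `≤ P₀` and, with
`P₀ ≥ 2`, `P_k + 1 ≤ P₀`.) -/
theorem dictStar_top (a : Fin 8 → ℤ) (i k j₀ j₁ j₂ : ℕ) (hi : i ∈ Icc 1 7) (hk : k ∈ Icc 1 7) (hik : i ≠ k)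
    (H₀ : RegionHyp a j₀) (H₁ : RegionHyp (a + slotDown k) j₁) (H₂ : RegionHyp (a + slotDown i) j₂)
    (hN : 2 ≤ bOfA a 0) :
    DictThreeTerm (starKappa (bOfA a) i k) (-fanCoeff (bOfA a) k) (fanCoeff (bOfA a) i)
      a (a + slotDown k) (a + slotDown i) j₀ j₁ j₂ := by
  obtain ⟨hi1', hi7⟩ := mem_Icc.1 hi
  obtain ⟨hk1', hk7⟩ := mem_Icc.1 hk
  obtain ⟨hQ0, hPh0, hP0⟩ := dict_values H₀
  obtain ⟨hQ1, hPh1, hP1⟩ := dict_values H₁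
  obtain ⟨hQ2, hPh2, hP2⟩ := dict_values H₂
  have hk1 : 1 ≤ bOfA a k := by
    have := H₁.2.2.1 k hk
    rw [bOfA_add_slotDown a k hk k (by omega), if_pos rfl] at this
    omega
  have hi1 : 1 ≤ bOfA a i := by
    have := H₂.2.2.1 i hi
    rw [bOfA_add_slotDown a i hi i (by omega), if_pos rfl] at this
    omega
  obtain ⟨-, hconv, hreg, hd0, -⟩ := H₀
  have hE : ∀ jk ∈ Epairs, bOfA a jk.1 + bOfA a jk.2 ≤ bOfA a 0 := epairs_le_of_converges a hconv
  have hPs : ∀ m, 1 ≤ m → m ≤ 7 → 0 ≤ bOfA a m ∧ 2 * bOfA a m ≤ bOfA a 0 + 1 := fun m h1 h7 =>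
    hreg m (mem_Icc.2 ⟨h1, h7⟩)
  have hPI : InBox (bOfA a) := ⟨by omega, fun j hj => by
    have := hPs (j + 1) (by omega) (by have := mem_range.1 hj; omega); omega⟩
  have hle : ∀ m ∈ Icc 1 7, bOfA a m ≤ bOfA a 0 := fun m hm => by
    obtain ⟨h1, h7⟩ := mem_Icc.1 hm
    have := hPs m h1 h7
    omega
  have hkN : bOfA a k + 1 ≤ bOfA a 0 := by
    have := hPs k hk1' hk7
    omega
  -- (1) the gauge-free STAR at `(P; i, k)`
  have W := star_wedge (bOfA a) hi hk hik hPI hd0 hle hi1 hk1 hkN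
  -- (2) the gauges of the two slot steps and (3) the polynomial identities
  obtain ⟨sk, rfl⟩ : ∃ s, k = s + 1 := ⟨k - 1, by omega⟩
  obtain ⟨si, rfl⟩ : ∃ s, i = s + 1 := ⟨i - 1, by omega⟩
  have Gk : rhoB (lowerAt (bOfA a) (sk + 1)) * ((dOf (bOfA a) : ℚ) + 1) * (chiOf (bOfA a) (sk + 1) : ℚ) =
      -((bOfA a (sk + 1) : ℚ) * edgeProd (bOfA a) (sk + 1) * rhoB (bOfA a)) :=
    rhoB_lower (bOfA a) (show sk < 7 by omega) hPI hk1 hd0 hE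
  have Gi : rhoB (lowerAt (bOfA a) (si + 1)) * ((dOf (bOfA a) : ℚ) + 1) * (chiOf (bOfA a) (si + 1) : ℚ) =
      -((bOfA a (si + 1) : ℚ) * edgeProd (bOfA a) (si + 1) * rhoB (bOfA a)) :=
    rhoB_lower (bOfA a) (show si < 7 by omega) hPI hi1 hd0 hE
  have Sk := starPi_gauge (bOfA a) hk
  have Si := starPi_gauge (bOfA a) hi
  -- non-vanishing
  have hd : ((dOf (bOfA a) : ℚ) + 1) ≠ 0 := by
    have : (0 : ℚ) ≤ dOf (bOfA a) := by exact_mod_cast hd0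
    exact ne_of_gt (by linarith)
  have hχ : ∀ s, 1 ≤ bOfA a s → (chiOf (bOfA a) s : ℚ) ≠ 0 := fun s hs => by
    have : (1 : ℤ) ≤ chiOf (bOfA a) s := by
      unfold chiOf; split_ifs
      · omega
      · exact le_refl _
    have : (1 : ℚ) ≤ chiOf (bOfA a) s := by exact_mod_cast this
    exact ne_of_gt (by linarith)
  -- the two lowered points are `P − e_k`, `P − e_i`
  have hQk : ∀ j, j ≤ 7 → bOfA (a + slotDown (sk + 1)) j = lowerAt (bOfA a) (sk + 1) j := fun j hj => by
    rw [bOfA_add_slotDown _ _ hk j hj, lowerAt_apply]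
    split_ifs with h
    · rw [h]
    · rfl
  have hQi : ∀ j, j ≤ 7 → bOfA (a + slotDown (si + 1)) j = lowerAt (bOfA a) (si + 1) j := fun j hj => by
    rw [bOfA_add_slotDown _ _ hi j hj, lowerAt_apply]
    split_ifs with h
    · rw [h]
    · rfl
  rw [rhoOf_eq_rhoB] at hQ0 hPh0 hP0 hQ1 hPh1 hP1 hQ2 hPh2 hP2
  rw [rhoB_congr hQk, (cas_congr hQk).1] at hQ1
  rw [rhoB_congr hQk, (cas_congr hQk).2.1] at hPh1
  rw [rhoB_congr hQk, (cas_congr hQk).2.2] at hP1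
  rw [rhoB_congr hQi, (cas_congr hQi).1] at hQ2
  rw [rhoB_congr hQi, (cas_congr hQi).2.1] at hPh2
  rw [rhoB_congr hQi, (cas_congr hQi).2.2] at hP2
  unfold DictThreeTerm
  rw [hQ0, hPh0, hP0, hQ1, hPh1, hP1, hQ2, hPh2, hP2]
  exact ⟨starTop_assemble (W casUW (by simp)) Gk Gi Sk Si hd (hχ _ hk1) (hχ _ hi1),
    starTop_assemble (W casUV (by simp)) Gk Gi Sk Si hd (hχ _ hk1) (hχ _ hi1),
    starTop_assemble (W casVW (by simp)) Gk Gi Sk Si hd (hχ _ hk1) (hχ _ hi1)⟩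

/-! ## 2. Level at most one, and `DictStar` -/

/-- The two slots of a non-edge pair are non-edge partners of each other (a finite check). -/
theorem mem_nonEdgePartners_of_not_epairs :
    ∀ j ∈ Icc 1 7, ∀ l ∈ Icc 1 7, j ≠ l → (j, l) ∉ Epairs → (l, j) ∉ Epairs → l ∈ nonEdgePartners j := by
  decide

/-- **`DictStar` at level `≤ 1` is trivial.**  `RegionHyp` at `a − s_k`, `a − s_i` forces `P_k, P_i ≥ 1`, the
region at `a` forces `2P_m ≤ P₀ + 1 ≤ 2`, so `P₀ = P_i = P_k = 1`; then `(i,k)` is not an edge pair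
(`P_i + P_k ≤ P₀` on edge pairs), hence a non-edge pair, and `starKappa(P,i,k) = 0`,
`fanCoeff(P,k) = fanCoeff(P,i) = 0` (the partner factor `P₀ + 1 − P_i − P_k` vanishes). -/
theorem dictStar_level_one (a : Fin 8 → ℤ) (i k j₀ j₁ j₂ : ℕ) (hi : i ∈ Icc 1 7) (hk : k ∈ Icc 1 7)
    (hik : i ≠ k) (H₀ : RegionHyp a j₀) (H₁ : RegionHyp (a + slotDown k) j₁)
    (H₂ : RegionHyp (a + slotDown i) j₂) (hN : bOfA a 0 ≤ 1) :
    DictThreeTerm (starKappa (bOfA a) i k) (-fanCoeff (bOfA a) k) (fanCoeff (bOfA a) i)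
      a (a + slotDown k) (a + slotDown i) j₀ j₁ j₂ := by
  obtain ⟨hi1', hi7⟩ := mem_Icc.1 hi
  obtain ⟨hk1', hk7⟩ := mem_Icc.1 hk
  have hk1 : 1 ≤ bOfA a k := by
    have := H₁.2.2.1 k hk
    rw [bOfA_add_slotDown a k hk k (by omega), if_pos rfl] at this
    omega
  have hi1 : 1 ≤ bOfA a i := by
    have := H₂.2.2.1 i hi
    rw [bOfA_add_slotDown a i hi i (by omega), if_pos rfl] at this
    omega
  obtain ⟨-, hconv, hreg, -, -⟩ := H₀
  have hbi := hreg i hi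
  have hbk := hreg k hk
  have hN1 : bOfA a 0 = 1 := by omega
  have hPi : bOfA a i = 1 := by omega
  have hPk : bOfA a k = 1 := by omega
  have hE : ∀ jk ∈ Epairs, bOfA a jk.1 + bOfA a jk.2 ≤ bOfA a 0 := epairs_le_of_converges a hconv
  have hik' : (i, k) ∉ Epairs := fun h => by have := hE _ h; simp only at this; omega
  have hki' : (k, i) ∉ Epairs := fun h => by have := hE _ h; simp only at this; omega
  have hmk : k ∈ nonEdgePartners i := mem_nonEdgePartners_of_not_epairs i hi k hk hik hik' hki'
  have hmi : i ∈ nonEdgePartners k := mem_nonEdgePartners_of_not_epairs k hk i hi hik.symm hki' hik'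
  have hκ : starKappa (bOfA a) i k = 0 := by rw [starKappa, hPi, hPk]; ring
  have hfi : fanCoeff (bOfA a) i = 0 := by
    rw [fanCoeff]
    refine mul_eq_zero_of_right _ (List.prod_eq_zero ?_)
    rw [List.mem_map]
    exact ⟨k, hmk, by simp [hN1, hPi, hPk]⟩
  have hfk : fanCoeff (bOfA a) k = 0 := by
    rw [fanCoeff]
    refine mul_eq_zero_of_right _ (List.prod_eq_zero ?_)
    rw [List.mem_map]
    exact ⟨i, hmi, by simp [hN1, hPi, hPk]⟩
  unfold DictThreeTerm
  rw [hκ, hfi, hfk]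
  simp

/-- **gen-1's dictionary STAR node `WedgeDictionaryThreeTerm.DictStar` HOLDS** (unconditionally): above level one by
the slot-7 four-term relation transported along `S₇` and the symmetric gauge (`dictStar_top`), at level `≤ 1`
trivially (`dictStar_level_one`). -/
theorem dictStar_holds : DictStar := by
  intro a i k j₀ j₁ j₂ hi hk hik H₀ H₁ H₂
  by_cases hN : 2 ≤ bOfA a 0
  · exact dictStar_top a i k j₀ j₁ j₂ hi hk hik H₀ H₁ H₂ hN
  · exact dictStar_level_one a i k j₀ j₁ j₂ hi hk hik H₀ H₁ H₂ (by omega)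

/-! ## 3. The descent with the dictionary side discharged (CONDITIONAL on the cellular families) -/

/-- **THE SHARP DESCENT, DICTIONARY SIDE DISCHARGED (PROVED implication; CONDITIONAL conclusion).**  With
`dictStar_holds`, E-L24's `dictPencilAxis_holds` and cert-1 g5's `dictPencilLevelOne_holds`, gen-1's sharp descent
`explicitPQ_of_terminal_sharp` needs only the two CELLULAR-side three-term families `CellStar`, `CellPencil`
(internally minted, OPEN) and `explicitPQ` at the terminal region points. -/
theorem explicitPQ_of_cells (hcS : CellStar) (hcP : CellPencil)
    (hterm : ∀ (a : Fin 8 → ℤ) (j : ℕ), Terminal a → RegionHyp a j →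
      (∀ (c : Fin 8 → ℤ) (j' : ℕ), bOfA c 0 < bOfA a 0 → RegionHyp c j' → ExplicitPQAt c j') → ExplicitPQAt a j) :
    explicitPQ :=
  explicitPQ_of_terminal_sharp hcS dictStar_holds hcP dictPencilAxis_holds dictPencilLevelOne_holds hterm

/-- Conversely, `explicitPQ` alone now implies the cellular STAR family (`cellStar_of_explicitPQ` with `DictStar`
discharged). -/
theorem cellStar_of_explicitPQ' (h : explicitPQ) : CellStar :=
  cellStar_of_explicitPQ h dictStar_holds

end Summit.KontsevichZagierPeriods.Zeta5Search.Elimination
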